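import Literature.NumberTheory.EllipticCurves.Gamma1NewformLSeriesFrickeProofs
import Literature.NumberTheory.EllipticCurves.NewformGaloisRepOddProofs
import Literature.NumberTheory.EllipticCurves.NewformGaloisRep
import Mathlib.NumberTheory.Padics.PadicVal.Basic
import HarnessLib

/-!
# Open image, VII: rational non-CM newforms have trivial nebentypus and even weight (proofs file)

Theorems only.  For a newform `f ∈ S_k(Γ₁(N))`:

* `IsNewform1.exists_heckeTAdjoint_eq_smul_of_not_dvd` — for a prime `p ∤ N`,
  `T_p^* f = a_p χ(d) f` with `d p ≡ 1 (mod N)` (`T_p^* = ⟨p⟩⁻¹ T_p`, Diamond–Shurman Thm. 5.5.3;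
  the `p ∤ N` branch of `IsNewform1.exists_heckeTAdjoint_eq_smul`, keeping track of the
  eigenvalue).
* `IsNewform1.conj_cuspCoeff_mul_nebentypus` — **`ā_p ε(p) = a_p`** for `p ∤ N`
  (Petersson adjointness, `eq_conj_of_heckeT_eq_smul_of_adjoint_eq_smul`; Ribet 1977, (3.3);
  Diamond–Shurman Thm. 5.5.3).
* `IsNewform1.nebentypus_eq_one_of_coeffCharField_eq_bot` — if `K_f = ℚ` and `f` has no complex
  multiplication (no Dirichlet character `η ≠ 1` with `η(p) a_p = a_p` for almost all primes `p`)
  then `ε = 1`: otherwise `η = ε` would do, as `a_p ∈ ℚ` is real and `ā_p ε(p) = a_p`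
  (Ribet 1977, §3, Remark 2 / proof of Prop. (4.4)–(4.5)).
* `IsNewform1.even_of_nebentypus_eq_one` — then `k` is even (`ε(−1) = (−1)^k`).
* `OpenImage.sq_ne_four_mul_prime_pow` — `r² ≠ 4 pᵐ` for `r ∈ ℚ`, `p` prime, `m` odd (parity of
  the `p`-adic valuation): a scalar Frobenius `ρ_f(Frob_p) = c · 1` would give
  `a_p² = 4 ε(p) p^{k−1}` (Ribet 1977, proof of Thm. (4.3) for `k` even).

## References

* K. A. Ribet, *Galois representations attached to eigenforms with Nebentypus*, LNM 601 (1977),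
  §3 ((3.3) `a_p = ε(p) ā_p`), §4 (Thm. (4.3), Prop. (4.4), Thm. (4.5)). [Ribet1977Nebentypus]
* F. Diamond, J. Shurman, *A First Course in Modular Forms*, GTM 228, Thm. 5.5.3.
  [DiamondShurman2005]
-/

noncomputable section

open scoped MatrixGroups ModularForm ComplexConjugate

open ConjAct Pointwise CongruenceSubgroup Matrix.SpecialLinearGroup UpperHalfPlane

namespace Literature.NumberTheory.EllipticCurves.ModularForms

variable {N : ℕ} [NeZero N] {k : ℤ}

/-! ### `T_p^* f = a_p χ(p)⁻¹ f` for `p ∤ N` -/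

/-- **`T_p^* = ⟨p⟩⁻¹ T_p` on a newform, `p ∤ N`**: `T_p^* f = a_p χ(d) f` where `χ` is the
nebentypus and `d p ≡ 1 (mod N)` (`diag(p,1) = γ diag(1,p) δ`, `γ ∈ Γ₁(N)`, `δ ∈ Γ₀(N)` with
`d_δ ≡ p⁻¹`; Diamond–Shurman, proof of Thm. 5.5.3).  This is the `p ∤ N` branch of
`IsNewform1.exists_heckeTAdjoint_eq_smul` with the eigenvalue made explicit.
[cite: DiamondShurman2005, proof of Thm. 5.5.3] -/
theorem IsNewform1.exists_heckeTAdjoint_eq_smul_of_not_dvd {f : CuspForm (Gamma1 N) k} (hf : IsNewform1 f)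
    {p : ℕ} (hp : p.Prime) (hpN : ¬ p ∣ N) :
    ∃ d : ZMod N, d * (p : ZMod N) = 1 ∧ (haveI : NeZero p := ⟨hp.ne_zero⟩;
      cuspHeckeOperatorₗ (Gamma1 N) k
        (diagGL (p : ℚ) 1 (Nat.cast_pos.mpr (NeZero.pos p)) one_pos) f) = (cuspCoeff f p * nebentypus f d) • f := by
  haveI : NeZero p := ⟨hp.ne_zero⟩
  set χ := nebentypus f with hχ_def
  have hfχ : f ∈ nebentypusSubspace N k χ := IsNewform1.mem_nebentypusSubspace_nebentypus_holds hf
  set a := cuspCoeff f p with ha_def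
  have hU : heckeT (Gamma1 N) k p f = a • f := by
    have := heckeT_eq_heckeEigenvalue_smul f p (hf.2.1 p hp)
    rwa [IsNewform1.heckeEigenvalue_eq_coeff_holds hf hp] at this
  have hUcoe : (⇑(heckeT (Gamma1 N) k p f) : ℍ → ℂ) = a • ⇑f := by
    rw [hU, CuspForm.IsGLPos.coe_smul]
  obtain ⟨γ, hγ, δ, hD, hδp⟩ := exists_glCast_diagGL_swap_eq_gamma1 N p hp hpN
  set D' : GL (Fin 2) ℚ := (diagGL 1 p one_pos (Nat.cast_pos.mpr (NeZero.pos p)) : GL (Fin 2) ℚ)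
    with hD'
  set D : GL (Fin 2) ℚ := (diagGL p 1 (Nat.cast_pos.mpr (NeZero.pos p)) one_pos : GL (Fin 2) ℚ)
    with hD_def
  have hδcast : glCast (slToGLPos (δ : SL(2, ℤ)) : GL (Fin 2) ℚ) = mapGL ℝ (δ : SL(2, ℤ)) :=
    glCast_slToGLPos _
  have hmul : ∀ a b : GL (Fin 2) ℚ, glCast (a * b) = glCast a * glCast b := fun a b ↦ map_mul _ a b
  have heq : cuspHeckeCorrespondence (Gamma1 N) (Gamma1 N) k D =
      cuspHeckeCorrespondence (Gamma1 N) (Gamma1 N) k (D' * (slToGLPos (δ : SL(2, ℤ)) : GL (Fin 2) ℚ)) :=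
    cuspHeckeCorrespondence_eq_of_eq_mul (Gamma1 N) (Gamma1 N) k hγ (one_mem _)
      (by rw [hmul, hδcast, mul_one, ← mul_assoc]; exact hD)
  letI := Fintype.ofFinite ((Gamma1 N : Subgroup (GL (Fin 2) ℝ)) ⧸
    (ConjAct.toConjAct (glCast D')⁻¹ • (Gamma1 N : Subgroup (GL (Fin 2) ℝ))).subgroupOf (Gamma1 N))
  obtain ⟨m, α, hα⟩ := exists_isDoubleCosetDecomp (Gamma1 N : Subgroup (GL (Fin 2) ℝ))
    (Gamma1 N) (glCast D')
  have hδn : ∀ x ∈ (Gamma1 N : Subgroup (GL (Fin 2) ℝ)),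
      mapGL ℝ (δ : SL(2, ℤ)) * x * (mapGL ℝ (δ : SL(2, ℤ)))⁻¹ ∈ (Gamma1 N : Subgroup (GL (Fin 2) ℝ)) :=
    conj_mapGL_mem_gamma1 N δ
  have hδn' : ∀ x ∈ (Gamma1 N : Subgroup (GL (Fin 2) ℝ)),
      (mapGL ℝ (δ : SL(2, ℤ)))⁻¹ * x * mapGL ℝ (δ : SL(2, ℤ)) ∈ (Gamma1 N : Subgroup (GL (Fin 2) ℝ)) := by
    intro x hx
    have h := conj_mapGL_mem_gamma1 N δ⁻¹ x hx
    simpa [map_inv] using h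
  have hβ : IsDoubleCosetDecomp (Gamma1 N : Subgroup (GL (Fin 2) ℝ)) (Gamma1 N)
      (glCast (D' * (slToGLPos (δ : SL(2, ℤ)) : GL (Fin 2) ℚ))) (fun i ↦ α i * mapGL ℝ (δ : SL(2, ℤ))) := by
    have h := hα.centre_mul_mul_normaliser (z := 1) (v := mapGL ℝ (δ : SL(2, ℤ)))
      (fun x ↦ by rw [one_mul, mul_one]) hδn hδn'
    simp only [one_mul] at h
    rwa [hmul, hδcast]
  refine ⟨Gamma0Map N δ, hδp, ?_⟩
  apply DFunLike.coe_injective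
  have eS : (⇑(cuspHeckeOperatorₗ (Gamma1 N) k
      (diagGL (p : ℚ) 1 (Nat.cast_pos.mpr (NeZero.pos p)) one_pos) f) : ℍ → ℂ) =
      ∑ i, ⇑f ∣[k] (α i * mapGL ℝ (δ : SL(2, ℤ))) := by
    change ⇑(cuspHeckeCorrespondence (Gamma1 N) (Gamma1 N) k D f) = _
    rw [heq]
    exact coe_cuspHeckeCorrespondence_eq_sum _ _ k _ hβ f
  have eT : (⇑(heckeT (Gamma1 N) k p f) : ℍ → ℂ) = ∑ i, ⇑f ∣[k] α i :=
    coe_cuspHeckeCorrespondence_eq_sum _ _ k D' hα f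
  rw [eS]
  simp_rw [SlashAction.slash_mul]
  rw [← SlashAction.sum_slash, ← eT, hUcoe, ModularForm.smul_slash, ← hδcast, σ_glCast, hδcast,
    coe_slash_eq_smul_of_mem_nebentypusSubspace hfχ δ, smul_smul, CuspForm.IsGLPos.coe_smul]

/-- **`ā_p ε(p) = a_p` for a newform on `Γ₁(N)` and a prime `p ∤ N`** (Ribet 1977, (3.3):
"`a_p = ε(p) ā_p`"): the eigenvalue of the Petersson adjoint `T_p^*` on `f` is `ā_p`
(`eq_conj_of_heckeT_eq_smul_of_adjoint_eq_smul`) and equals `a_p ε(p)⁻¹`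
(`exists_heckeTAdjoint_eq_smul_of_not_dvd`). [cite: Ribet1977Nebentypus, (3.3)] -/
theorem IsNewform1.conj_cuspCoeff_mul_nebentypus {f : CuspForm (Gamma1 N) k} (hf : IsNewform1 f)
    {p : ℕ} (hp : p.Prime) (hpN : ¬ p ∣ N) :
    conj (cuspCoeff f p) * nebentypus f (p : ZMod N) = cuspCoeff f p := by
  haveI : NeZero p := ⟨hp.ne_zero⟩
  obtain ⟨d, hdp, hb⟩ := hf.exists_heckeTAdjoint_eq_smul_of_not_dvd hp hpN
  have ha : heckeT (Gamma1 N) k p f = cuspCoeff f p • f := by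
    have := heckeT_eq_heckeEigenvalue_smul f p (hf.2.1 p hp)
    rwa [IsNewform1.heckeEigenvalue_eq_coeff_holds hf hp] at this
  have hconj := eq_conj_of_heckeT_eq_smul_of_adjoint_eq_smul hf.ne_zero ha hb
  -- `conj a_p = a_p ε(d)` with `d p = 1`
  rw [← hconj, mul_assoc, ← map_mul, hdp, map_one, mul_one]

/-! ### `K_f = ℚ` and no complex multiplication force `ε = 1` and `k` even -/

/-- Elements of `K_f = ℚ(aₙ, ε(n))` are rational when `K_f = ⊥`. [folklore] -/
theorem exists_ratCast_eq_of_coeffCharField_eq_bot {f : CuspForm (Gamma1 N) k} (hQ : coeffCharField f = ⊥)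
    {z : ℂ} (hz : z ∈ coeffCharField f) : ∃ r : ℚ, (r : ℂ) = z := by
  rw [hQ, IntermediateField.mem_bot] at hz
  obtain ⟨r, hr⟩ := hz
  exact ⟨r, by rw [← hr]; rfl⟩

/-- The Fourier coefficients of `f` are rational when `K_f = ⊥`. [folklore] -/
theorem exists_ratCast_eq_cuspCoeff_of_coeffCharField_eq_bot {f : CuspForm (Gamma1 N) k}
    (hQ : coeffCharField f = ⊥) (n : ℕ) : ∃ r : ℚ, (r : ℂ) = cuspCoeff f n :=
  exists_ratCast_eq_of_coeffCharField_eq_bot hQ (cuspCoeff_mem_coeffCharField f n)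

/-- **A newform with `K_f = ℚ` and without complex multiplication has trivial nebentypus.**
If `ε ≠ 1` then `η = ε` is a Dirichlet character `≠ 1` with `η(p) a_p = a_p` for every prime
`p ∤ N` — since `a_p ∈ ℚ` is real and `ā_p ε(p) = a_p` — contradicting the non-CM hypothesis
(Ribet 1977, §3 and proof of Thm. (4.5): a form with an "extra twist" by its own character and
real coefficients has CM). [cite: Ribet1977Nebentypus, (3.3) and §4] -/
theorem IsNewform1.nebentypus_eq_one_of_coeffCharField_eq_bot {f : CuspForm (Gamma1 N) k} (hf : IsNewform1 f)
    (hQ : coeffCharField f = ⊥)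
    (hCM : ¬ ∃ (M : ℕ) (ψ : DirichletCharacter ℂ M), ψ ≠ 1 ∧
        ∀ᶠ p : ℕ in Filter.cofinite, p.Prime →
          ψ (p : ZMod M) * (qExpansion 1 ⇑f).coeff p = (qExpansion 1 ⇑f).coeff p) :
    nebentypus f = 1 := by
  by_contra hne
  apply hCM
  refine ⟨N, nebentypus f, hne, ?_⟩
  rw [Filter.eventually_cofinite]
  refine (N.divisors.finite_toSet).subset fun p hp ↦ ?_
  simp only [Set.mem_setOf_eq, Classical.not_imp] at hp
  obtain ⟨hpprime, hpne⟩ := hp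
  rw [Finset.mem_coe, Nat.mem_divisors]
  refine ⟨?_, NeZero.ne N⟩
  by_contra hpN
  apply hpne
  -- `a_p` is rational, hence real
  obtain ⟨r, hr⟩ := exists_ratCast_eq_cuspCoeff_of_coeffCharField_eq_bot hQ p
  have hreal : conj (cuspCoeff f p) = cuspCoeff f p := by rw [← hr]; exact map_ratCast _ r
  have h := hf.conj_cuspCoeff_mul_nebentypus hpprime hpN
  rw [hreal, mul_comm] at h
  exact h

/-- **… and then the weight is even** (`ε(−1) = (−1)^k`, `IsNewform1.nebentypus_neg_one`).
[cite: DiamondShurman2005, §4.3 p. 119] -/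
theorem IsNewform1.even_of_nebentypus_eq_one {f : CuspForm (Gamma1 N) k} (hf : IsNewform1 f)
    (h1 : nebentypus f = 1) : Even k := by
  have h := hf.nebentypus_neg_one
  rw [h1, MulChar.one_apply (isUnit_one.neg)] at h
  rcases Int.even_or_odd k with hk | hk
  · exact hk
  · exfalso
    rw [hk.neg_one_zpow] at h
    norm_num at h

/-! ### No scalar Frobenius: `r² ≠ 4 pᵐ` for odd `m` -/

/-- For a prime `p`, odd `m` and rational `r`: `r² ≠ 4 pᵐ` (the `p`-adic valuation of the left
side is even, of the right side odd).  For a rational non-CM newform of (even) weight `k` this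
excludes a scalar Frobenius `ρ_f(Frob_p) = c · 1`, which would give `a_p = 2c`,
`c² = p^{k−1}` (Ribet 1977, proof of Thm. (4.3), `k` even). [cite: Ribet1977Nebentypus, proof of Thm. (4.3)] -/
theorem OpenImage.sq_ne_four_mul_prime_pow {p : ℕ} (hp : p.Prime) {m : ℕ} (hm : Odd m) (r : ℚ) :
    r ^ 2 ≠ 4 * (p : ℚ) ^ m := by
  haveI : Fact p.Prime := ⟨hp⟩
  have hp0 : (0 : ℚ) < p := by exact_mod_cast hp.pos
  intro h
  have hr0 : r ≠ 0 := by
    rintro rfl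
    have : (4 : ℚ) * (p : ℚ) ^ m ≠ 0 := by positivity
    exact this (by rw [← h]; ring)
  have hv := congrArg (padicValRat p) h
  rw [padicValRat.pow r] at hv
  have h4 : (4 : ℚ) ≠ 0 := by norm_num
  have hpm : ((p : ℚ) ^ m) ≠ 0 := by positivity
  rw [padicValRat.mul h4 hpm, padicValRat.pow (p : ℚ), padicValRat.self hp.one_lt] at hv
  -- `padicValRat p 4` is even (`2` if `p = 2`, else `0`)
  have heven : Even (padicValRat p 4) := by
    rcases hp.eq_two_or_odd' with rfl | hodd
    · have h22 : padicValRat 2 4 = padicValRat 2 ((2 : ℚ) ^ 2) := by norm_num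
      have hself : padicValRat 2 (2 : ℚ) = 1 := by exact_mod_cast padicValRat.self (p := 2) one_lt_two
      rw [h22, padicValRat.pow (2 : ℚ), hself]
      norm_num
    · have : padicValRat p 4 = 0 := by
        rw [show (4 : ℚ) = ((4 : ℕ) : ℚ) by norm_num, padicValRat.of_nat]
        norm_cast
        refine padicValNat.eq_zero_of_not_dvd ?_
        intro hdvd
        have h2 : p ∣ 2 ^ 2 := by simpa using hdvd
        have := (Nat.prime_dvd_prime_iff_eq hp Nat.prime_two).1 (hp.dvd_of_dvd_pow h2)
        subst this
        exact (Nat.not_even_iff_odd.2 hodd) even_two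
      rw [this]; exact ⟨0, rfl⟩
  have hodd : Odd (padicValRat p 4 + (m : ℤ) * 1) := by
    rw [mul_one]
    exact heven.add_odd (by exact_mod_cast hm)
  rw [← hv] at hodd
  exact (Int.not_even_iff_odd.2 hodd) ⟨padicValRat p r, by push_cast; ring⟩

end Literature.NumberTheory.EllipticCurves.ModularForms
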